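import Summits.ValiantsHypothesis.ValiantsHypothesis.Theorems.LacunarySymmetroidMatrixDescartesCensusDoorA34ConfluentNineWall

/-!
# `MatrixDescartes` census — DOOR A at `(3,4)`: THE CONFLUENT NINETEEN, part 1 (kernel) — the four-letter `3 × 3` pencil
# `det(1 + X^{d₁}S₁ + X^{d₂}S₂ + X^{d₃}S₃)` as an explicit TWENTY-term fewnomial on the triple sums (any real letters, any support),
# and the scaling `X ↦ x₀X`

HONEST FRAMING.  Object-search cell `pub-symmetroid`, door-A seat `val-sym-door-p3` (g25); helper file beside the OPEN typed
statement `DoorA34 = PosRootLawAt 3 4 18` (route item `Theses.LacunarySymmetroid.DoorA34`, stmt-ValiantsHypothesis-19980),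
asserted nowhere here.  This is the (3,4) analogue of `det_pencil_eq_sum_ten` (part 1 of the confluent nine): it feeds the
confluent Vandermonde kernel `two_point_relation'` at the format of `DoorA34` itself (part 2 of the confluent nineteen,
`…ConfluentNineteen`: no nineteenfold root when `2d₁ < d₂ < d₃`).  `det_one_add_three_fin_three` expands `det(1 + sA + tB + uC)` with
the twenty mixed invariants as coefficients (the fully polarised `stu`-coefficient by inclusion–exclusion of determinants),
`det_pencil_four_eq_sum_twenty` is the `Fin 20`-indexed polynomial identity (`Polynomial.funext`), `det_pencil_four_comp_scale` /
`dvd_comp_scale_nineteen` the scaling symmetry.  Nothing here bounds `ζ_sym(3,4)`; `DoorA34`, Claim L and `MatrixDescartes`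
(stmt-ValiantsHypothesis-18050) stay OPEN; registers unchanged; nothing on `VP ≠ VNP`.
[folklore] Leibniz expansion of a `3 × 3` determinant, polarisation; certificates by `simp` / `ring`.
-/

-- `Summit.ValiantsHypothesis.ValiantsHypothesis.…` repeats a component by the D-0017 layout
-- (single-conjunct summit), which the `dupNamespace` linter flags; the name is mandated.
set_option linter.dupNamespace false

namespace Summit.ValiantsHypothesis.ValiantsHypothesis.Theorems.LacunarySymmetroidMatrixDescartes.Census.ConfluentNine

open Polynomial Finset
open scoped BigOperators Matrix

/-! ## 12. The four-letter `3 × 3` pencil as a twenty-term fewnomial -/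

/-- `det(1 + s·A + t·B + u·C)` for `3 × 3` matrices as a cubic in `(s,t,u)` with the twenty mixed invariants as coefficients
(the `stu`-coefficient by inclusion–exclusion of determinants). [folklore] -/
theorem det_one_add_three_fin_three (S₁ S₂ S₃ : Matrix (Fin 3) (Fin 3) ℝ) (s t u : ℝ) :
    (1 + s • S₁ + t • S₂ + u • S₃).det
      = 1
        + S₁.trace * s
        + S₂.trace * t
        + S₃.trace * u
        + (S₁ 0 0 * S₁ 1 1 - S₁ 0 1 * S₁ 1 0 + (S₁ 0 0 * S₁ 2 2 - S₁ 0 2 * S₁ 2 0) + (S₁ 1 1 * S₁ 2 2 - S₁ 1 2 * S₁ 2 1)) * s ^ 2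
        + (S₁ 0 0 * S₂ 1 1 + S₂ 0 0 * S₁ 1 1 - S₁ 0 1 * S₂ 1 0 - S₂ 0 1 * S₁ 1 0 + (S₁ 0 0 * S₂ 2 2 + S₂ 0 0 * S₁ 2 2 - S₁ 0 2 * S₂ 2 0 - S₂ 0 2
            * S₁ 2 0) + (S₁ 1 1 * S₂ 2 2 + S₂ 1 1 * S₁ 2 2 - S₁ 1 2 * S₂ 2 1 - S₂ 1 2 * S₁ 2 1)) * (s * t)
        + (S₁ 0 0 * S₃ 1 1 + S₃ 0 0 * S₁ 1 1 - S₁ 0 1 * S₃ 1 0 - S₃ 0 1 * S₁ 1 0 + (S₁ 0 0 * S₃ 2 2 + S₃ 0 0 * S₁ 2 2 - S₁ 0 2 * S₃ 2 0 - S₃ 0 2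
            * S₁ 2 0) + (S₁ 1 1 * S₃ 2 2 + S₃ 1 1 * S₁ 2 2 - S₁ 1 2 * S₃ 2 1 - S₃ 1 2 * S₁ 2 1)) * (s * u)
        + (S₂ 0 0 * S₂ 1 1 - S₂ 0 1 * S₂ 1 0 + (S₂ 0 0 * S₂ 2 2 - S₂ 0 2 * S₂ 2 0) + (S₂ 1 1 * S₂ 2 2 - S₂ 1 2 * S₂ 2 1)) * t ^ 2
        + (S₂ 0 0 * S₃ 1 1 + S₃ 0 0 * S₂ 1 1 - S₂ 0 1 * S₃ 1 0 - S₃ 0 1 * S₂ 1 0 + (S₂ 0 0 * S₃ 2 2 + S₃ 0 0 * S₂ 2 2 - S₂ 0 2 * S₃ 2 0 - S₃ 0 2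
            * S₂ 2 0) + (S₂ 1 1 * S₃ 2 2 + S₃ 1 1 * S₂ 2 2 - S₂ 1 2 * S₃ 2 1 - S₃ 1 2 * S₂ 2 1)) * (t * u)
        + (S₃ 0 0 * S₃ 1 1 - S₃ 0 1 * S₃ 1 0 + (S₃ 0 0 * S₃ 2 2 - S₃ 0 2 * S₃ 2 0) + (S₃ 1 1 * S₃ 2 2 - S₃ 1 2 * S₃ 2 1)) * u ^ 2
        + S₁.det * s ^ 3
        + (S₁.adjugate * S₂).trace * (s ^ 2 * t)
        + (S₁.adjugate * S₃).trace * (s ^ 2 * u)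
        + (S₂.adjugate * S₁).trace * (s * t ^ 2)
        + ((S₁ + S₂ + S₃).det - (S₁ + S₂).det - (S₁ + S₃).det - (S₂ + S₃).det + S₁.det + S₂.det + S₃.det) * (s * t * u)
        + (S₃.adjugate * S₁).trace * (s * u ^ 2)
        + S₂.det * t ^ 3
        + (S₂.adjugate * S₃).trace * (t ^ 2 * u)
        + (S₃.adjugate * S₂).trace * (t * u ^ 2)
        + S₃.det * u ^ 3 := by
  simp only [Matrix.det_fin_three, Matrix.adjugate_fin_three, Matrix.trace_fin_three, Matrix.mul_apply, Fin.sum_univ_three,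
    Matrix.add_apply, Matrix.smul_apply, Matrix.one_apply, smul_eq_mul]
  simp
  ring

/-- Evaluation of the four-letter pencil `(1, S₁, S₂, S₃)` on `(0, d₁, d₂, d₃)` at a real point. [folklore] -/
theorem eval_pencil_four (d₁ d₂ d₃ : ℕ) (S₁ S₂ S₃ : Matrix (Fin 3) (Fin 3) ℝ) (x : ℝ) :
    (∑ l, x ^ (![0, d₁, d₂, d₃] : Fin 4 → ℕ) l • (![1, S₁, S₂, S₃] : Fin 4 → Matrix (Fin 3) (Fin 3) ℝ) l)
      = 1 + x ^ d₁ • S₁ + x ^ d₂ • S₂ + x ^ d₃ • S₃ := by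
  simp [Fin.sum_univ_four, add_assoc]

/-- **The twenty-term fewnomial.**  For every support `(0,d₁,d₂,d₃)` and all real `3 × 3` letters, the pencil determinant
`det(1 + X^{d₁}S₁ + X^{d₂}S₂ + X^{d₃}S₃)` is the explicit fewnomial `∑_{|α|=3} m_α X^{α·d}` on the twenty triple sums. [folklore] -/
theorem det_pencil_four_eq_sum_twenty (d₁ d₂ d₃ : ℕ) (S₁ S₂ S₃ : Matrix (Fin 3) (Fin 3) ℝ) :
    (∑ l, (X : ℝ[X]) ^ (![0, d₁, d₂, d₃] : Fin 4 → ℕ) l • ((![1, S₁, S₂, S₃] : Fin 4 → Matrix (Fin 3) (Fin 3) ℝ) l).map C).det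
      = ∑ i : Fin 20, C ((![1,
            S₁.trace,
            S₂.trace,
            S₃.trace,
            (S₁ 0 0 * S₁ 1 1 - S₁ 0 1 * S₁ 1 0 + (S₁ 0 0 * S₁ 2 2 - S₁ 0 2 * S₁ 2 0) + (S₁ 1 1 * S₁ 2 2 - S₁ 1 2 * S₁ 2 1)),
            (S₁ 0 0 * S₂ 1 1 + S₂ 0 0 * S₁ 1 1 - S₁ 0 1 * S₂ 1 0 - S₂ 0 1 * S₁ 1 0 + (S₁ 0 0 * S₂ 2 2 + S₂ 0 0 * S₁ 2 2 - S₁ 0 2 * S₂ 2 0 - S₂ 0 2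
                * S₁ 2 0) + (S₁ 1 1 * S₂ 2 2 + S₂ 1 1 * S₁ 2 2 - S₁ 1 2 * S₂ 2 1 - S₂ 1 2 * S₁ 2 1)),
            (S₁ 0 0 * S₃ 1 1 + S₃ 0 0 * S₁ 1 1 - S₁ 0 1 * S₃ 1 0 - S₃ 0 1 * S₁ 1 0 + (S₁ 0 0 * S₃ 2 2 + S₃ 0 0 * S₁ 2 2 - S₁ 0 2 * S₃ 2 0 - S₃ 0 2
                * S₁ 2 0) + (S₁ 1 1 * S₃ 2 2 + S₃ 1 1 * S₁ 2 2 - S₁ 1 2 * S₃ 2 1 - S₃ 1 2 * S₁ 2 1)),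
            (S₂ 0 0 * S₂ 1 1 - S₂ 0 1 * S₂ 1 0 + (S₂ 0 0 * S₂ 2 2 - S₂ 0 2 * S₂ 2 0) + (S₂ 1 1 * S₂ 2 2 - S₂ 1 2 * S₂ 2 1)),
            (S₂ 0 0 * S₃ 1 1 + S₃ 0 0 * S₂ 1 1 - S₂ 0 1 * S₃ 1 0 - S₃ 0 1 * S₂ 1 0 + (S₂ 0 0 * S₃ 2 2 + S₃ 0 0 * S₂ 2 2 - S₂ 0 2 * S₃ 2 0 - S₃ 0 2
                * S₂ 2 0) + (S₂ 1 1 * S₃ 2 2 + S₃ 1 1 * S₂ 2 2 - S₂ 1 2 * S₃ 2 1 - S₃ 1 2 * S₂ 2 1)),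
            (S₃ 0 0 * S₃ 1 1 - S₃ 0 1 * S₃ 1 0 + (S₃ 0 0 * S₃ 2 2 - S₃ 0 2 * S₃ 2 0) + (S₃ 1 1 * S₃ 2 2 - S₃ 1 2 * S₃ 2 1)),
            S₁.det,
            (S₁.adjugate * S₂).trace,
            (S₁.adjugate * S₃).trace,
            (S₂.adjugate * S₁).trace,
            ((S₁ + S₂ + S₃).det - (S₁ + S₂).det - (S₁ + S₃).det - (S₂ + S₃).det + S₁.det + S₂.det + S₃.det),
            (S₃.adjugate * S₁).trace,
            S₂.det,
            (S₂.adjugate * S₃).trace,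
            (S₃.adjugate * S₂).trace,
            S₃.det] : Fin 20 → ℝ) i) * X ^ ((![0, d₁, d₂, d₃, 2 * d₁, d₁ + d₂, d₁ + d₃, 2 * d₂, d₂ + d₃, 2 * d₃, 3 * d₁, 2 * d₁ + d₂, 2 * d₁ + d₃,
                d₁ + 2 * d₂, d₁ + d₂ + d₃, d₁ + 2 * d₃, 3 * d₂, 2 * d₂ + d₃, d₂ + 2 * d₃, 3 * d₃] : Fin 20 → ℕ) i) := by
  apply Polynomial.funext
  intro x
  rw [SymmetroidDescartes.eval_det_pencil, eval_pencil_four, det_one_add_three_fin_three, eval_finsetSum]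
  simp only [Fin.sum_univ_succ, Fin.sum_univ_zero, eval_mul, eval_C, eval_pow, eval_X]
  simp
  ring

/-! ## 13. Scaling to `x₀ = 1` -/

/-- Scaling symmetry `X ↦ x₀·X` for the four-letter pencil. [folklore] -/
theorem det_pencil_four_comp_scale (d₁ d₂ d₃ : ℕ) (S₁ S₂ S₃ : Matrix (Fin 3) (Fin 3) ℝ) (x₀ : ℝ) :
    (∑ l, (X : ℝ[X]) ^ (![0, d₁, d₂, d₃] : Fin 4 → ℕ) l • ((![1, S₁, S₂, S₃] : Fin 4 → Matrix (Fin 3) (Fin 3) ℝ) l).map C).det.comp (C x₀ * X)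
      = (∑ l, (X : ℝ[X]) ^ (![0, d₁, d₂, d₃] : Fin 4 → ℕ) l • ((![1, (x₀ ^ d₁ • S₁), (x₀ ^ d₂ • S₂),
          (x₀ ^ d₃ • S₃)] : Fin 4 → Matrix (Fin 3) (Fin 3) ℝ) l).map C).det := by
  apply Polynomial.funext
  intro y
  rw [eval_comp, SymmetroidDescartes.eval_det_pencil, eval_mul, eval_C, eval_X, SymmetroidDescartes.eval_det_pencil]
  congr 1
  simp [Fin.sum_univ_four, mul_pow, smul_smul, mul_comm]

/-- A nineteenfold root at `x₀` becomes a nineteenfold root at `1` after the scaling `X ↦ x₀·X`. [folklore] -/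
theorem dvd_comp_scale_nineteen {p : ℝ[X]} {x₀ : ℝ} (h : (X - C x₀) ^ 19 ∣ p) :
    (X - C 1) ^ 19 ∣ p.comp (C x₀ * X) := by
  obtain ⟨r, hr⟩ := h
  refine ⟨C x₀ ^ 19 * r.comp (C x₀ * X), ?_⟩
  rw [hr, mul_comp, pow_comp, sub_comp, X_comp, C_comp]
  have e : C x₀ * X - C x₀ = C x₀ * (X - C (1 : ℝ)) := by rw [map_one]; ring
  rw [e]; ring

end Summit.ValiantsHypothesis.ValiantsHypothesis.Theorems.LacunarySymmetroidMatrixDescartes.Census.ConfluentNine
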